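import Literature.AlgebraicGeometry.Frobenioids.PadicKummerIsoTransport
import Literature.NumberTheory.GaloisRepresentations.ContinuousCupProductCompat
import HarnessLib

/-!
# Frobenioids II, Def. 2.2 (ii) / Thm. 2.4 (i): the cup product `H¹(H_A, μ_N(A)) × H¹(H_A, ℤ/Nℤ) →
# F_N(A)` and its naturality along isomorphisms of Definition 2.2 contexts

Mochizuki, *The geometry of Frobenioids II*, Kyushu J. Math. **62** (2008), §2, Def. 2.2 (ii) p. 18:
"the cup product on group cohomology … determines an isomorphism `H¹(H, μ_N(A)) ⥲ H^ab ⊗ H²(H, μ_N(A))`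
… we obtain a natural isomorphism `H¹(H_A, μ_N(A)) ⥲ H_A^ab ⊗ F_N(A)`" [cite: MochizukiFrdII2008, Def 2.2 p.18];
Thm. 2.4 (i) p. 19: the induced isomorphisms `H¹ ⥲ H¹`, `F_N ⥲ F_N` "are compatible with the …
reciprocity maps". Cell abc-iut, cross-layer row **L1-γ₁**, milestone M2 (seat abc-iut-L2-t12): the
tree carries that isomorphism as a DATUM (`Kummer.DualityIso`, abc-iut-L1-t7) and its naturality as a
HYPOTHESIS of the Thm. 2.4 (i) discharge (abc-iut-L1-d4). Toward CONSTRUCTING it as the cup-product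
map, this file supplies, over the pre-cell continuous cup product (`ContinuousCupProduct*.lean`):

* `ContPairing.cupProduct_map_pair` (generic): naturality of the cup product along a COMPATIBLE PAIR
  `(θ : H → G, coefficient maps)` — `H²(θ, γ)(a ∪ b) = H¹(θ, α) a ∪ H¹(θ, β) b`
  [cite: NeukirchSchmidtWingberg2008, I §4 (1.4.2)] (the trunk has the two special cases
  `cupProduct_res`, `cupProduct_map`);
* `Kummer.muPowPairing N O H_A` — the pairing `μ_N(A) × ℤ/Nℤ → μ_N(A)`, `(ζ, n) ↦ ζⁿ`, as a continuous
  `H_A`-equivariant pairing of the coefficient modules `muTopRep`, `trivTopRep` of Def. 2.2 (ii)(c);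
* `Kummer.cupH2`, **`Kummer.cupFN N O H_A q : H¹(H_A, μ_N(A)) →ₗ H¹(H_A, ℤ/Nℤ) →ₗ F_N(A)`** — the cup
  product followed by `H²(H_A, μ_N(A)) ↠ F_N(A)`;
* **`Def22Context.Iso.isoFN_cupFN`** — for an isomorphism `e` of Definition 2.2 contexts
  (`PadicKummer.Def22Context.Iso`), `e.isoFN (a ∪ b) = (e∗a) ∪ (e∗b)` with `e∗` the transports on
  `H¹(−, μ_N)` and `H¹(−, ℤ/Nℤ)` of abc-iut-L1-d4's `transportMu` / `transportTriv` (push along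
  `((H₂)_{A₂} ⥲ (H₁)_{A₁}, μ_N(A₁) ⥲ μ_N(A₂))`): the (γ₁) naturality in its cup-product form.

Not here (next milestones): the comparison `H¹(H_A, μ_N(A))` (Mathlib `groupCohomology.H1`, the domain of
`DualityIso`) `≅ continuousCohomology 1 (muTopRep …)` is `Kummer.h1MuEquiv` (`KummerH1Discrete.lean`);
the identification `Hom(H¹(H_A, ℤ/N), F_N) ≅ H_A^ab ⊗ F_N` and the bijectivity (local Tate duality,
`Literature.NumberTheory.GaloisRepresentations.localDuality_bijective`) follow. Classical; nothing
here concerns [IUTchIII]; universe `0` as in `KummerReciprocity.lean`.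
-/

noncomputable section

open CategoryTheory

/-! ### Generic: naturality of the cup product along a compatible pair -/

namespace Literature.NumberTheory.GaloisRepresentations

namespace ContPairing

open TopRep ContRepresentation ContinuousCohomology

universe u v

variable {R : Type u} [CommRing R] [TopologicalSpace R]
  {G : Type v} [Group G] [TopologicalSpace G] [IsTopologicalGroup G] [LocallyCompactSpace G]
  {H : Type v} [Group H] [TopologicalSpace H] [IsTopologicalGroup H] [LocallyCompactSpace H]
  {X Y Z : TopRep.{v} R G} {X' Y' Z' : TopRep.{v} R H}
  (θ : H →ₜ* G) (P : ContPairing X Y Z) (P' : ContPairing X' Y' Z')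
  (α : res (θ : H →* G) X ⟶ X') (β : res (θ : H →* G) Y ⟶ Y') (γ : res (θ : H →* G) Z ⟶ Z')
  (hc : ∀ x y, γ.hom (P.toLin x y) = P'.toLin (α.hom x) (β.hom y))

omit [LocallyCompactSpace G] [LocallyCompactSpace H] in
include hc in
/-- The inhomogeneous cup-product cocycle is natural along a compatible pair `(θ; α, β, γ)`:
`γ ∘ (f ∪ g) ∘ (θ × θ) = (α ∘ f ∘ θ) ∪ (β ∘ g ∘ θ)`. [cite: NeukirchSchmidtWingberg2008, I §4 (1.4.2)] -/
theorem cupCocycle_map_pair (f : contOneCocycles X) (g : contOneCocycles Y) :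
    contTwoCocycles.pullback θ γ (P.cupCocycle f g) =
      P'.cupCocycle (contOneCocycles.pullback θ α f) (contOneCocycles.pullback θ β g) := by
  refine Subtype.ext (ContinuousMap.ext fun p => ?_)
  obtain ⟨σ, τ⟩ := p
  rw [contTwoCocycles.pullback_apply, cupCocycle_apply, cupCocycle_apply,
    contOneCocycles.pullback_apply, contOneCocycles.pullback_apply,
    contOneCocycles.pullback_apply, hc, _root_.map_mul θ, map_sub]

include hc in
/-- **Naturality of the cup product along a compatible pair** `(θ : H → G; α, β, γ)` with
`γ⟨x, y⟩ = ⟨α x, β y⟩'`: `H²(θ, γ)(a ∪ b) = H¹(θ, α) a ∪' H¹(θ, β) b` (both the change of group and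
the change of coefficients; `cupProduct_res` and `cupProduct_map` are the cases `α = β = γ = 𝟙` and
`θ = id`). [cite: NeukirchSchmidtWingberg2008, I §4 (1.4.2)] -/
theorem cupProduct_map_pair (a : continuousCohomology 1 X) (b : continuousCohomology 1 Y) :
    ContinuousCohomology.map θ γ 2 (P.cupProduct a b) =
      P'.cupProduct (ContinuousCohomology.map θ α 1 a) (ContinuousCohomology.map θ β 1 b) := by
  obtain ⟨f, rfl⟩ := oneCocycleClass_surjective _ a
  obtain ⟨g, rfl⟩ := oneCocycleClass_surjective _ b
  rw [cupProduct_oneCocycleClass_eq_twoCocycleClass, map_twoCocycleClass,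
    cupCocycle_map_pair θ P P' α β γ hc, map_oneCocycleClass, map_oneCocycleClass,
    cupProduct_oneCocycleClass_eq_twoCocycleClass]

end ContPairing

end Literature.NumberTheory.GaloisRepresentations

/-! ### The pairing `μ_N(A) × ℤ/Nℤ → μ_N(A)` and the cup product into `F_N(A)` -/

namespace Literature.AlgebraicGeometry.Frobenioids

namespace Kummer

open Literature.NumberTheory.GaloisRepresentations

variable {Γ : Type} [Group Γ] [TopologicalSpace Γ] [DiscreteTopology Γ]
  (N : ℕ) (O : Type) [CommMonoid O] [MulDistribMulAction Γ O] (HA : Subgroup Γ)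

/-- `μ_N(A)` is killed by `N` (additively: `N • ζ = 0`). [cite: MochizukiFrdII2008, Def 2.1 (i) p.16] -/
theorem Mu.nsmul_eq_zero (x : Additive (Mu N O)) : N • x = 0 := by
  apply Additive.toMul.injective
  rw [toMul_nsmul, toMul_zero]
  have h := (Additive.toMul x).val_mem
  rw [mem_rootsOfUnity] at h
  exact Subtype.ext h

/-- `μ_N(A)` as a `ℤ/Nℤ`-module (`n • ζ = ζⁿ`; reducible, used locally).
[cite: MochizukiFrdII2008, Def 2.1 (i) p.16] -/
abbrev Mu.zmodModule : Module (ZMod N) (Additive (Mu N O)) :=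
  AddCommGroup.zmodModule (Mu.nsmul_eq_zero N O)

/-- The `ℤ`-bilinear map `μ_N(A) × ℤ/Nℤ → μ_N(A)`, `(ζ, n) ↦ ζⁿ` (on `Additive μ_N(A)`: `n • ζ`).
[cite: MochizukiFrdII2008, Def 2.2 p.18] -/
def muPowBilin : Additive (Mu N O) →ₗ[ℤ] ZMod N →ₗ[ℤ] Additive (Mu N O) :=
  letI : Module (ZMod N) (Additive (Mu N O)) := Mu.zmodModule N O
  LinearMap.mk₂ ℤ (fun (x : Additive (Mu N O)) (n : ZMod N) => (n • x : Additive (Mu N O)))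
    (fun x x' n => smul_add n x x')
    (fun c x n => (ZMod.map_smul (zsmulAddGroupHom c : Additive (Mu N O) →+ Additive (Mu N O)) n x).symm)
    (fun x n n' => add_smul n n' x)
    (fun c x n => by
      change (c • n) • x = c • (n • x)
      rw [zsmul_eq_mul, mul_smul, Int.cast_smul_eq_zsmul])

omit [TopologicalSpace Γ] [DiscreteTopology Γ] in
/-- `muPowBilin ζ n = n • ζ` (`= ζⁿ`). [cite: MochizukiFrdII2008, Def 2.2 p.18] -/
theorem muPowBilin_apply (x : Additive (Mu N O)) (n : ZMod N) :
    muPowBilin N O x n = (letI : Module (ZMod N) (Additive (Mu N O)) := Mu.zmodModule N O; n • x) := rfl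

omit [TopologicalSpace Γ] [DiscreteTopology Γ] in
/-- Any additive map `μ_N(A₁) → μ_N(A₂)` commutes with the pairings (`f(ζⁿ) = f(ζ)ⁿ`).
[cite: MochizukiFrdII2008, Def 2.2 p.18] -/
theorem map_muPowBilin {O' : Type} [CommMonoid O'] (f : Additive (Mu N O) →+ Additive (Mu N O'))
    (x : Additive (Mu N O)) (n : ZMod N) : f (muPowBilin N O x n) = muPowBilin N O' (f x) n := by
  letI : Module (ZMod N) (Additive (Mu N O)) := Mu.zmodModule N O
  letI : Module (ZMod N) (Additive (Mu N O')) := Mu.zmodModule N O'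
  rw [muPowBilin_apply, muPowBilin_apply]
  exact ZMod.map_smul f n x

/-- A discrete group is locally compact (for the cup product on its continuous cochains).
[cite: NeukirchSchmidtWingberg2008, I §4 (1.4.2)] -/
theorem locallyCompactSpace_of_discrete (K : Type) [TopologicalSpace K] [DiscreteTopology K] :
    LocallyCompactSpace K :=
  ⟨fun x _n hn => ⟨{x}, by simp, by simpa using mem_of_mem_nhds hn, isCompact_singleton⟩⟩

/-- **The pairing `μ_N(A) × ℤ/Nℤ → μ_N(A)`, `(ζ, n) ↦ ζⁿ`** (the cup-product pairing of FrdII p. 18,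
`H¹(H_A, μ_N(A)) × H¹(H_A, ℤ/Nℤ) → H²(H_A, μ_N(A))`), as a continuous `H_A`-equivariant bilinear pairing
of the discrete coefficient modules of Def. 2.2 (ii)(c). [cite: MochizukiFrdII2008, Def 2.2 p.18] -/
def muPowPairing : ContPairing (muTopRep N O HA) (trivTopRep N HA) (muTopRep N O HA) :=
  haveI : DiscreteTopology (muTopRep N O HA) := inferInstanceAs (DiscreteTopology (Additive (Mu N O)))
  haveI : DiscreteTopology (trivTopRep N HA) := inferInstanceAs (DiscreteTopology (ZMod N))
  ContPairing.ofDiscrete (muPowBilin N O) (fun g x n =>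
    (map_muPowBilin N O ((muTopRep N O HA).ρ g).toLinearMap.toAddMonoidHom x n).symm)

omit [TopologicalSpace Γ] [DiscreteTopology Γ] in
/-- `muPowPairing` is `muPowBilin` on elements. [cite: MochizukiFrdII2008, Def 2.2 p.18] -/
theorem muPowPairing_toLin (x : Additive (Mu N O)) (n : ZMod N) :
    (muPowPairing N O HA).toLin x n = muPowBilin N O x n := rfl

/-- The cup product `H¹(H_A, μ_N(A)) × H¹(H_A, ℤ/Nℤ) → H²(H_A, μ_N(A))` for `muPowPairing` (continuous
cohomology of the discrete `H_A`; FrdII p. 18). [cite: MochizukiFrdII2008, Def 2.2 p.18] -/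
abbrev cupH2 :=
  haveI : LocallyCompactSpace HA := locallyCompactSpace_of_discrete HA
  (muPowPairing N O HA).cupProduct

variable {H : Type} [Group H] [TopologicalSpace H] [IsTopologicalGroup H] (q : H →ₜ* HA)

/-- The projection `H²(H_A, μ_N(A)) ↠ F_N(A)`. [cite: MochizukiFrdII2008, Def 2.2 (ii) p.17] -/
abbrev toFN : continuousCohomology 2 (muTopRep N O HA) →+ FN N O HA q :=
  QuotientAddGroup.mk' (fnKer N O HA q)

/-- **The cup product `H¹(H_A, μ_N(A)) × H¹(H_A, ℤ/Nℤ) → F_N(A)`** (FrdII p. 18: "induced by the cup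
product", followed by `H²(H_A, μ_N(A)) ↠ F_N(A)`), bi-additive. [cite: MochizukiFrdII2008, Def 2.2 p.18] -/
def cupFN : continuousCohomology 1 (muTopRep N O HA) →+
    continuousCohomology 1 (trivTopRep N HA) →+ FN N O HA q :=
  AddMonoidHom.mk' (fun a => (toFN N O HA q).comp (cupH2 N O HA a).toAddMonoidHom) fun a a' => by
    ext b
    simp only [AddMonoidHom.coe_comp, Function.comp_apply, LinearMap.toAddMonoidHom_coe, map_add,
      LinearMap.add_apply, AddMonoidHom.add_apply]

/-- `cupFN a b = [a ∪ b]`. [cite: MochizukiFrdII2008, Def 2.2 p.18] -/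
@[simp] theorem cupFN_apply (a : continuousCohomology 1 (muTopRep N O HA))
    (b : continuousCohomology 1 (trivTopRep N HA)) :
    cupFN N O HA q a b = toFN N O HA q (cupH2 N O HA a b) :=
  rfl

end Kummer

/-! ### Naturality along isomorphisms of Definition 2.2 contexts (Theorem 2.4 (i)) -/

namespace PadicKummer

namespace Def22Context.Iso

open Kummer Literature.NumberTheory.GaloisRepresentations

variable {X₁ X₂ : Def22Context} (e : Def22Context.Iso X₁ X₂) (N : ℕ)

/-- The coefficient map `μ_N(A₁) → μ_N(A₂)` of the transport commutes with the `ℤ/Nℤ`-actions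
(`f'(ζⁿ) = f'(ζ)ⁿ`). [cite: MochizukiFrdII2008, Thm 2.4 (i) p.19] -/
theorem transportMu_f'_muPowPairing (x : Additive (Mu N X₁.O)) (n : ZMod N) :
    (e.transportMu N).f'.hom ((muPowPairing N X₁.O X₁.HA).toLin x n) =
      (muPowPairing N X₂.O X₂.HA).toLin ((e.transportMu N).f'.hom x) ((e.transportTriv N).f'.hom n) :=
  map_muPowBilin N X₁.O
    ((e.transportMu N).f'.hom.toLinearMap.toAddMonoidHom :
      Additive (Mu N X₁.O) →+ Additive (Mu N X₂.O)) x n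

/-- **Naturality of the cup product `H¹(μ_N) × H¹(ℤ/N) → H²(μ_N)` along a context isomorphism**: the
`H²`-transport of `a ∪ b` is the cup product of the `H¹`-transports (push along
`((H₂)_{A₂} ⥲ (H₁)_{A₁}, μ_N(A₁) ⥲ μ_N(A₂))`, abc-iut-L1-d4's `transportMu` / `transportTriv`).
[cite: MochizukiFrdII2008, Thm 2.4 (i) p.19] -/
theorem push_cupH2 (a : continuousCohomology 1 (muTopRep N X₁.O X₁.HA))
    (b : continuousCohomology 1 (trivTopRep N X₁.HA)) :
    ((e.transportMu N).push 2).hom (cupH2 N X₁.O X₁.HA a b) =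
      cupH2 N X₂.O X₂.HA (((e.transportMu N).push 1).hom a) (((e.transportTriv N).push 1).hom b) := by
  haveI : LocallyCompactSpace X₁.HA := locallyCompactSpace_of_discrete X₁.HA
  haveI : LocallyCompactSpace X₂.HA := locallyCompactSpace_of_discrete X₂.HA
  have h := ContPairing.cupProduct_map_pair e.haInv (muPowPairing N X₁.O X₁.HA)
    (muPowPairing N X₂.O X₂.HA) (e.transportMu N).f' (e.transportTriv N).f' (e.transportMu N).f'
    (e.transportMu_f'_muPowPairing N) a b
  exact h

/-- **(γ₁) in cup-product form — Theorem 2.4 (i) compatibility of `F_N(A₁) ⥲ F_N(A₂)` with the cup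
products**: `e.isoFN (a ∪ b) = (e∗a) ∪ (e∗b)` in `F_N(A₂)`. [cite: MochizukiFrdII2008, Thm 2.4 (i) p.19] -/
theorem isoFN_cupFN (a : continuousCohomology 1 (muTopRep N X₁.O X₁.HA))
    (b : continuousCohomology 1 (trivTopRep N X₁.HA)) :
    e.isoFN N (cupFN N X₁.O X₁.HA X₁.qHA a b) =
      cupFN N X₂.O X₂.HA X₂.qHA (((e.transportMu N).push 1).hom a)
        (((e.transportTriv N).push 1).hom b) := by
  rw [cupFN_apply, cupFN_apply, ← push_cupH2]
  exact e.isoFN_mk N _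

end Def22Context.Iso

end PadicKummer

end Literature.AlgebraicGeometry.Frobenioids
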